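import Literature.Geometry.Lorentzian.TameChartCompactnessFramed
import HarnessLib

/-!
# The framed datum defined by converging charts carries its charts as converging far charts

Twin of `SpacetimeLocalConvergenceOfChartsFar.lean` for the FRAMED datum
`LocalSubconvergence.ofChartsFramed` (`TameChartCompactnessFramed.lean`): for charts
`Ψₙ : B.domain → 𝓢ₙ` pinched in a frame field `𝔉` on the domain of a model background `B` whose
components converge to those of a near-framed chart `L`, the clause
`LocalSubconvergence.FarChartsConverge` holds with far charts the charts themselves and limit far
chart `id`, for ANY reference form `B.bilin` (e.g. `Kerr.regionBackground M a r₀`): the comparison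
maps are the charts, and `(Ψ_{φ m}^* g − g₀) − (G − g₀) = Ψ_{φ m}^* g − G → 0` on compacts.

## References
* P. Petersen, *Riemannian Geometry*, 2nd ed., 2006, Ch. 10 §3.2. [Petersen2006]
* M. T. Anderson, Cheeger–Gromov theory and applications to general relativity, 2004, Def. 1.1. [Anderson2004]
-/

noncomputable section

open Set Filter TopologicalSpace Function
open scoped Manifold ContDiff Topology ENNReal

universe u

namespace Literature.Geometry.Lorentzian

namespace NearFramedChart

variable (B : ModelBackground) {𝔉 : FrameField B.domain} (L : NearFramedChart B.domain 𝔉)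
  (hO : IsConnected (B.domain : Set E4))

/-- **The deviation of the identity chart of the near-framed chart spacetime from the background
is `G − g₀` on the domain.** [folklore] -/
theorem deviationExtend_id_background_eqOn :
    EqOn ((L.spacetime hO).deviationExtend B (id : B.domain → (L.spacetime hO).carrier))
      (L.G - B.bilin) (B.domain : Set E4) := by
  intro y hy
  refine ((L.spacetime hO).deviationExtend_coe B (id : B.domain → (L.spacetime hO).carrier)
    ⟨y, hy⟩).trans ?_
  ext v w
  have hid : mfderiv 𝓘(ℝ, E4) (𝓡 4) (id : B.domain → (L.spacetime hO).carrier) ⟨y, hy⟩ =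
      ContinuousLinearMap.id ℝ E4 := mfderiv_id
  show (L.spacetime hO).metric.val ⟨y, hy⟩
      (mfderiv 𝓘(ℝ, E4) (𝓡 4) (id : B.domain → (L.spacetime hO).carrier) ⟨y, hy⟩ v)
      (mfderiv 𝓘(ℝ, E4) (𝓡 4) (id : B.domain → (L.spacetime hO).carrier) ⟨y, hy⟩ w) - B.bilin y v w =
    L.G y v w - B.bilin y v w
  rw [hid]
  rfl

end NearFramedChart

namespace Spacetime

namespace LocalSubconvergence

variable {𝓢ₙ : ℕ → Spacetime.{u} 4} {pₙ : ∀ n, (𝓢ₙ n).carrier}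

/-- **The charts of `ofChartsFramed` converge as far charts, for any reference form.**
[cite: Anderson2004, Def. 1.1] -/
theorem farChartsConverge_ofChartsFramed (B : ModelBackground) {𝔉 : FrameField B.domain}
    (hO : IsConnected (B.domain : Set E4))
    {y₀ : E4} (hy₀ : y₀ ∈ (B.domain : Set E4)) (Ψ : ∀ n, B.domain → (𝓢ₙ n).carrier)
    (hΨ : ∀ n, ContMDiff 𝓘(ℝ, E4) (𝓡 4) ∞ (Ψ n)) (hinj : ∀ n, Injective (Ψ n))
    (hcentre : ∀ n, Ψ n ⟨y₀, hy₀⟩ = pₙ n)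
    (hfut : ∀ n, (𝓢ₙ n).timeOrientation.IsFutureDirected
      (mfderiv 𝓘(ℝ, E4) (𝓡 4) (Ψ n) ⟨y₀, hy₀⟩ (𝔉.Ainv y₀ (E4.basisVector 0))))
    (hpinch : ∀ n, ∀ y ∈ (B.domain : Set E4), ‖(𝓢ₙ n).framedDeviation 𝔉 (Ψ n) ⟨y₀, hy₀⟩ y‖ < 1)
    (L : NearFramedChart B.domain 𝔉) {φ : ℕ → ℕ} (hφ : StrictMono φ) (k : ℕ)
    (hlim : ∀ K ⊆ (B.domain : Set E4), IsCompact K →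
      Tendsto (fun m ↦ supCkENorm K k
        ((𝓢ₙ (φ m)).metricInCoords (Ψ (φ m) ∘ (chartAt E4 (⟨y₀, hy₀⟩ : B.domain)).symm) - L.G))
        atTop (𝓝 0)) :
    (ofChartsFramed hO hy₀ Ψ hΨ hinj hcentre hfut hpinch L hφ k hlim).FarChartsConverge B Ψ
      (id : B.domain → (L.spacetime hO).carrier) where
  eventually_embed_comp_eq _ _ _ := Eventually.of_forall fun _ _ _ ↦ rfl
  tendsto_supCkENorm_deviationExtend K hK hKO := by
    refine (hlim K hKO hK).congr fun m ↦ supCkENorm_congr fun y hy ↦ ?_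
    filter_upwards [B.domain.2.mem_nhds (hKO hy)] with z hz
    have h1 := (𝓢ₙ (φ m)).metricInCoords_comp_chartAt_symm_sub_eq_deviation B (Ψ (φ m))
      ⟨y₀, hy₀⟩ hz (((hΨ (φ m)) ⟨z, hz⟩).mdifferentiableAt (by simp))
    have h2 : (𝓢ₙ (φ m)).deviationExtend B (Ψ (φ m)) z = (𝓢ₙ (φ m)).deviation B (Ψ (φ m)) ⟨z, hz⟩ :=
      (𝓢ₙ (φ m)).deviationExtend_coe B (Ψ (φ m)) ⟨z, hz⟩
    have h3 := L.deviationExtend_id_background_eqOn B hO hz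
    show (𝓢ₙ (φ m)).metricInCoords (Ψ (φ m) ∘ (chartAt E4 (⟨y₀, hy₀⟩ : B.domain)).symm) z - L.G z =
      (𝓢ₙ (φ m)).deviationExtend B (Ψ (φ m)) z -
        (L.spacetime hO).deviationExtend B (id : B.domain → (L.spacetime hO).carrier) z
    rw [h2, ← h1, h3]
    ext v w
    simp only [sub_apply, Pi.sub_apply]
    ring

end LocalSubconvergence

/-- **Subconvergence with far charts from converging framed-pinched charts** (module docstring).
[cite: Anderson2004, Def. 1.1] -/
theorem SubconvergesLocallyWithFarChartsTo.ofChartsFramed {𝓢ₙ : ℕ → Spacetime.{u} 4}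
    {pₙ : ∀ n, (𝓢ₙ n).carrier} (B : ModelBackground) {𝔉 : FrameField B.domain}
    (hO : IsConnected (B.domain : Set E4))
    {y₀ : E4} (hy₀ : y₀ ∈ (B.domain : Set E4)) (Ψ : ∀ n, B.domain → (𝓢ₙ n).carrier)
    (hΨ : ∀ n, ContMDiff 𝓘(ℝ, E4) (𝓡 4) ∞ (Ψ n)) (hinj : ∀ n, Injective (Ψ n))
    (hcentre : ∀ n, Ψ n ⟨y₀, hy₀⟩ = pₙ n)
    (hfut : ∀ n, (𝓢ₙ n).timeOrientation.IsFutureDirected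
      (mfderiv 𝓘(ℝ, E4) (𝓡 4) (Ψ n) ⟨y₀, hy₀⟩ (𝔉.Ainv y₀ (E4.basisVector 0))))
    (hpinch : ∀ n, ∀ y ∈ (B.domain : Set E4), ‖(𝓢ₙ n).framedDeviation 𝔉 (Ψ n) ⟨y₀, hy₀⟩ y‖ < 1)
    (L : NearFramedChart B.domain 𝔉) {φ : ℕ → ℕ} (hφ : StrictMono φ) {k : ℕ}
    (hlim : ∀ K ⊆ (B.domain : Set E4), IsCompact K →
      Tendsto (fun m ↦ supCkENorm K k
        ((𝓢ₙ (φ m)).metricInCoords (Ψ (φ m) ∘ (chartAt E4 (⟨y₀, hy₀⟩ : B.domain)).symm) - L.G))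
        atTop (𝓝 0)) :
    SubconvergesLocallyWithFarChartsTo 𝓢ₙ pₙ (L.spacetime hO) ⟨y₀, hy₀⟩ k B Ψ
      (id : B.domain → (L.spacetime hO).carrier) :=
  ⟨LocalSubconvergence.ofChartsFramed hO hy₀ Ψ hΨ hinj hcentre hfut hpinch L hφ k hlim,
    LocalSubconvergence.farChartsConverge_ofChartsFramed B hO hy₀ Ψ hΨ hinj hcentre hfut hpinch L hφ k
      hlim⟩

end Spacetime

end Literature.Geometry.Lorentzian

end
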